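import Summits.QuantumAdvantage.QuantumAdvantage.Theorems.LinnikCubicClassGroupsPureCubicClassGroupFBQPStubCubicGiantStepCycleRedSem
import Literature.Computability.Cryptography.GiantStepCycleOfChain
import Literature.NumberTheory.CubicFields.PureCubicLatticeSemantics
import Literature.NumberTheory.NumberFields.PureCubicOrder

/-!
# Crux `LinnikCubicClassGroups.PureCubicClassGroupFBQP` (stmt-QuantumAdvantage-11544) — stub `stub_cubicGiantStepCycle`, part Chain

Line `arakelov-giant-step-cycle`, stub `stub_cubicGiantStepCycle` (S3b-W1), SECOND PART: the reduction programs
WALK VORONOI'S CHAIN. Let `K` be a cubic field with a real embedding `σ₁` and a non-real `σ₂`, `θ ∈ K` with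
`θ³ = ab²` (`ab` squarefree, `ab ≠ 1`), `ν = voronoiChain σ₁ σ₂ 𝓞_K 1` the chain of positive relative minima of
`𝓞_K` through `1`, and `J i = ν(i)⁻¹ 𝓞_K` the reduced principal ideals along it. Under the named specifications
`LexMinSpec`, `LogSpec`, `InvSpec`, `ScaleSpec`, `RedLEq`, `IsBigEq`, `OrdSpec` of the programs
(`CubicClassTableProgramSpecs.lean`):

* `chain_step` — on a canonical code of `J i`: `lexE` is `ν(i)⁻¹ν(i+1)` (`voronoiChain_cylinder_step`),
  `(redL c).1` is a canonical code of `J (i+1)`, `(redL c).2` is within `1` of `2^prec (ℓ(i+1) − ℓ i)`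
  (`ℓ i = log σ₁ ν(i)`), and the flag `isBigL c` is the big-gap test `11 σ₁ν(i) ≤ 10 σ₁ν(i+1)`;
* `exists_chainCode` — every `J i` HAS a canonical code (walk from `ordL = code of 𝓞_K = J 0` and use the
  `n₀`-periodicity of the labels), unique by `PureCubicCodes.canon_unique`;
* `iterate_chain_step` — `k` unflagged steps from `(code (J i), acc)` reach `(code (J (i+k)), acc')` with
  `|acc' − acc − 2^prec (ℓ(i+k) − ℓ i)| ≤ k`;
* `flagLoop_chain` — the flagged loop of the walk programs stops at the first big gap (`iterate_flag_eq`);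
* `exists_sIndex`, `sIndex_window`, `sZero_window` — index combinatorics of the enumeration `s` of the big-gap
  indices (the next big gap after any index is at most `5` steps away);
* `exists_chainCodes` — closed form of `exists_chainCode` with the code function `cd : ℤ → ℕ × List ℤ` chosen
  (the sub-goal registered for this file).
-/

-- the problem namespace repeats the summit name (`QuantumAdvantage.QuantumAdvantage`)
set_option linter.dupNamespace false

namespace Summit.QuantumAdvantage.QuantumAdvantage.Theorems.LinnikCubicClassGroups

open scoped NumberField nonZeroDivisors
open NumberField
open Literature.Computability.Cryptography
open Literature.Computability.Cryptography.CubicClassTable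
open Literature.NumberTheory.CubicFields
open Literature.NumberTheory.CubicFields.PureCubicCodes (Mem Canon val canon_unique)
open Literature.NumberTheory.NumberFields.PureCubic

section Chain

variable {K : Type} [Field K] [NumberField K] (hdeg : Module.finrank ℚ K = 3)
  {σ₁ : K →+* ℝ} {σ₂ : K →+* ℂ} (hσ₂ : ∃ z : K, starRingEnd ℂ (σ₂ z) ≠ σ₂ z)
  (ε : (𝓞 K)ˣ) (hε : 1 < σ₁ (algebraMap (𝓞 K) K ε))
  {a b : ℕ} (hab : Squarefree (a * b)) (hab1 : a * b ≠ 1) {θ : K} (hθ : θ ^ 3 = ((a * b ^ 2 : ℕ) : K))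
  {lexE : (ℕ × ℕ) × (ℕ × List ℤ) → ℤ × ℤ × ℤ × ℕ}
  {logE : (ℕ × ℕ) × ((ℤ × ℤ × ℤ × ℕ) × ℕ) → ℤ}
  {invE : (ℕ × ℕ) × (ℤ × ℤ × ℤ × ℕ) → ℤ × ℤ × ℤ × ℕ}
  {latScale : (ℕ × ℕ) × ((ℕ × List ℤ) × (ℤ × ℤ × ℤ × ℕ)) → ℕ × List ℤ}
  {redL : ((ℕ × ℕ) × ℕ) × (ℕ × List ℤ) → (ℕ × List ℤ) × ℤ}
  {isBigL : (ℕ × ℕ) × (ℕ × List ℤ) → Bool}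
  {ordL : ℕ × ℕ → ℕ × List ℤ}


include hdeg hσ₂ ε hε in
/-- The chain elements `ν(i)` are positive relative minima of `𝓞_K`; in particular `σ₁ ν(i) > 0`, `ν(i) ≠ 0`
and `J i = ν(i)⁻¹𝓞_K ≠ 0`. -/
theorem voronoiChain_one_facts (i : ℤ) :
    voronoiChain σ₁ σ₂ (1 : FractionalIdeal (𝓞 K)⁰ K) (1 : K) i ∈ posRelMinima σ₁ σ₂ (1 : FractionalIdeal (𝓞 K)⁰ K) ∧ 0 < σ₁ (voronoiChain σ₁ σ₂ (1 : FractionalIdeal (𝓞 K)⁰ K) (1 : K) i) ∧ voronoiChain σ₁ σ₂ (1 : FractionalIdeal (𝓞 K)⁰ K) (1 : K) i ≠ 0 ∧ (FractionalIdeal.spanSingleton (𝓞 K)⁰ (voronoiChain σ₁ σ₂ (1 : FractionalIdeal (𝓞 K)⁰ K) (1 : K) i)⁻¹ * (1 : FractionalIdeal (𝓞 K)⁰ K)) ≠ 0 := by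
  have h := voronoiChain_mem hdeg hσ₂ ε hε (one_mem_posRelMinima_one hdeg hσ₂) i
  refine ⟨h, h.2, h.1.2.1, ?_⟩
  rw [mul_one]
  exact FractionalIdeal.spanSingleton_ne_zero_iff.mpr (inv_ne_zero h.1.2.1)

/-- `J 0 = 𝓞_K` (`ν(0) = 1`). -/
theorem chainLabel_zero : (FractionalIdeal.spanSingleton (𝓞 K)⁰ (voronoiChain σ₁ σ₂ (1 : FractionalIdeal (𝓞 K)⁰ K) (1 : K) 0)⁻¹ * (1 : FractionalIdeal (𝓞 K)⁰ K)) = 1 := by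
  rw [voronoiChain_zero, inv_one, FractionalIdeal.spanSingleton_one, one_mul]

variable (σ₁ σ₂) in
/-- **The order code codes `J 0`.** Under `OrdSpec`, `ordL (a, b)` is a canonical code of `J 0 = 𝓞_K`. -/
theorem ordL_codes_zero (hord : OrdSpec a b K θ ordL) :
    Canon (ordL (a, b)) ∧ ∀ φ : K, Mem θ b (ordL (a, b)) φ ↔ φ ∈ (FractionalIdeal.spanSingleton (𝓞 K)⁰ (voronoiChain σ₁ σ₂ (1 : FractionalIdeal (𝓞 K)⁰ K) (1 : K) 0)⁻¹ * (1 : FractionalIdeal (𝓞 K)⁰ K)) := by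
  refine ⟨hord.1, fun φ => ?_⟩
  rw [hord.2 φ, chainLabel_zero, mem_one_iff_isIntegral]

include hdeg hσ₂ ε hε hab hθ in
/-- **One reduction step along the chain.** On a canonical code `c` of `J i`: `lexE c` has value `ν(i)⁻¹ν(i+1)`
(the least element of the unit cylinder of `J i`, `voronoiChain_cylinder_step`), `(redL c).1` is a canonical code
of `J (i+1)`, `(redL c).2` is within `1` of `2^prec (log σ₁ν(i+1) − log σ₁ν(i))` (the quotient exceeds `1 ≥ 2^-prec`),
and `isBigL c` is the big-gap test at `i`. -/
theorem chain_step (hlex : LexMinSpec a b K θ σ₁ σ₂ lexE) (hlog : LogSpec a b logE) (hinv : InvSpec a b K θ invE)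
    (hscale : ScaleSpec a b K θ latScale) (hred : RedLEq a b K θ lexE logE invE latScale redL)
    (hbig : IsBigEq a b K θ lexE isBigL) (prec : ℕ) (i : ℤ) {c : ℕ × List ℤ} (hc : Canon c)
    (hcJ : ∀ φ : K, Mem θ b c φ ↔ φ ∈ (FractionalIdeal.spanSingleton (𝓞 K)⁰ (voronoiChain σ₁ σ₂ (1 : FractionalIdeal (𝓞 K)⁰ K) (1 : K) i)⁻¹ * (1 : FractionalIdeal (𝓞 K)⁰ K))) :
    (1 ≤ (lexE ((a, b), c)).2.2.2 ∧ val θ b (lexE ((a, b), c)) = (voronoiChain σ₁ σ₂ (1 : FractionalIdeal (𝓞 K)⁰ K) (1 : K) i)⁻¹ * voronoiChain σ₁ σ₂ (1 : FractionalIdeal (𝓞 K)⁰ K) (1 : K) (i + 1)) ∧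
    (Canon (redL (((a, b), prec), c)).1 ∧ ∀ φ : K, Mem θ b (redL (((a, b), prec), c)).1 φ ↔ φ ∈ (FractionalIdeal.spanSingleton (𝓞 K)⁰ (voronoiChain σ₁ σ₂ (1 : FractionalIdeal (𝓞 K)⁰ K) (1 : K) (i + 1))⁻¹ * (1 : FractionalIdeal (𝓞 K)⁰ K))) ∧
    |((redL (((a, b), prec), c)).2 : ℝ) - 2 ^ prec * (Real.log (σ₁ (voronoiChain σ₁ σ₂ (1 : FractionalIdeal (𝓞 K)⁰ K) (1 : K) (i + 1))) - Real.log (σ₁ (voronoiChain σ₁ σ₂ (1 : FractionalIdeal (𝓞 K)⁰ K) (1 : K) i)))| ≤ 1 ∧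
    (isBigL ((a, b), c) = true ↔ 11 * σ₁ (voronoiChain σ₁ σ₂ (1 : FractionalIdeal (𝓞 K)⁰ K) (1 : K) i) ≤ 10 * σ₁ (voronoiChain σ₁ σ₂ (1 : FractionalIdeal (𝓞 K)⁰ K) (1 : K) (i + 1))) := by
  have hone := one_mem_posRelMinima_one (σ₁ := σ₁) hdeg hσ₂
  obtain ⟨hm, hpos, hlt, hmin, hnext⟩ := voronoiChain_cylinder_step hdeg hσ₂ ε hε hone i
  obtain ⟨-, hpi, h0i, hJ0⟩ := voronoiChain_one_facts hdeg hσ₂ ε hε i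
  obtain ⟨-, hpi1, -, -⟩ := voronoiChain_one_facts hdeg hσ₂ ε hε (i + 1)
  obtain ⟨hden, hval⟩ := val_lexE_eq_of_least hlex hc hJ0 hcJ hm hpos hlt hmin
  obtain ⟨hcan, -, hmemJ⟩ := redL_fst_spec hlex hinv hscale hred prec hc hJ0 hcJ
  have hquot : σ₁ ((voronoiChain σ₁ σ₂ (1 : FractionalIdeal (𝓞 K)⁰ K) (1 : K) i)⁻¹ * voronoiChain σ₁ σ₂ (1 : FractionalIdeal (𝓞 K)⁰ K) (1 : K) (i + 1)) = σ₁ (voronoiChain σ₁ σ₂ (1 : FractionalIdeal (𝓞 K)⁰ K) (1 : K) (i + 1)) / σ₁ (voronoiChain σ₁ σ₂ (1 : FractionalIdeal (𝓞 K)⁰ K) (1 : K) i) := by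
    rw [map_mul, map_inv₀, inv_mul_eq_div]
  have hgt : 1 < σ₁ (voronoiChain σ₁ σ₂ (1 : FractionalIdeal (𝓞 K)⁰ K) (1 : K) (i + 1)) / σ₁ (voronoiChain σ₁ σ₂ (1 : FractionalIdeal (𝓞 K)⁰ K) (1 : K) i) := by
    rw [one_lt_div hpi]
    exact voronoiChain_strictMono hdeg hσ₂ ε hε hone (lt_add_one i)
  refine ⟨⟨hden, hval⟩, ⟨hcan, fun φ => by rw [hmemJ φ, hval, hnext]⟩, ?_, ?_⟩
  · have hp : (1 : ℝ) / 2 ^ prec ≤ σ₁ (val θ b (lexE ((a, b), c))) := by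
      rw [hval, hquot]
      exact le_trans (div_le_one_of_le₀ (one_le_pow₀ (by norm_num)) (by positivity)) hgt.le
    have h := redL_snd_spec hab hθ hlex hlog hred prec hc hJ0 hcJ hp
    rwa [hval, hquot, Real.log_div hpi1.ne' hpi.ne'] at h
  · rw [isBigL_iff_of_specs hdeg hσ₂ hlex hbig hc hJ0 hcJ, hval, hquot, le_div_iff₀ hpi]
    constructor <;> intro h <;> linarith

include hdeg hσ₂ ε hε hab hθ in
/-- **Every reduced ideal `J i` along the chain has a canonical code** (under the specifications and a unit
period `ν(i + n₀) = u ν(i)` of the chain): walk `k ≥ 0` steps from `ordL` (a code of `J 0`) to code `J k`, and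
`J i = J (i mod n₀)` since labels are unit-invariant. -/
theorem exists_chainCode (hlex : LexMinSpec a b K θ σ₁ σ₂ lexE) (hlog : LogSpec a b logE)
    (hinv : InvSpec a b K θ invE) (hscale : ScaleSpec a b K θ latScale)
    (hred : RedLEq a b K θ lexE logE invE latScale redL) (hbig : IsBigEq a b K θ lexE isBigL)
    (hord : OrdSpec a b K θ ordL) {n₀ : ℕ} (hn₀ : 0 < n₀) (u : (𝓞 K)ˣ)
    (hper : ∀ i, voronoiChain σ₁ σ₂ (1 : FractionalIdeal (𝓞 K)⁰ K) (1 : K) (i + n₀) = algebraMap (𝓞 K) K u * voronoiChain σ₁ σ₂ (1 : FractionalIdeal (𝓞 K)⁰ K) (1 : K) i) (i : ℤ) :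
    ∃ c : ℕ × List ℤ, Canon c ∧ ∀ φ : K, Mem θ b c φ ↔ φ ∈ (FractionalIdeal.spanSingleton (𝓞 K)⁰ (voronoiChain σ₁ σ₂ (1 : FractionalIdeal (𝓞 K)⁰ K) (1 : K) i)⁻¹ * (1 : FractionalIdeal (𝓞 K)⁰ K)) := by
  have hnat : ∀ k : ℕ, ∃ c : ℕ × List ℤ, Canon c ∧ ∀ φ : K, Mem θ b c φ ↔ φ ∈ (FractionalIdeal.spanSingleton (𝓞 K)⁰ (voronoiChain σ₁ σ₂ (1 : FractionalIdeal (𝓞 K)⁰ K) (1 : K) ((k : ℤ)))⁻¹ * (1 : FractionalIdeal (𝓞 K)⁰ K)) := by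
    intro k
    induction k with
    | zero => exact ⟨ordL (a, b), by exact_mod_cast ordL_codes_zero σ₁ σ₂ hord⟩
    | succ k ih =>
      obtain ⟨c, hc, hcJ⟩ := ih
      obtain ⟨-, h, -, -⟩ := chain_step hdeg hσ₂ ε hε hab hθ hlex hlog hinv hscale hred hbig 0 (k : ℤ) hc hcJ
      exact ⟨_, h.1, by push_cast at h ⊢; exact h.2⟩
  obtain ⟨c, hc, hcJ⟩ := hnat (i % n₀).toNat
  refine ⟨c, hc, fun φ => ?_⟩
  have hone := one_mem_posRelMinima_one (σ₁ := σ₁) hdeg hσ₂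
  have hk : (((i % n₀).toNat : ℕ) : ℤ) = i % n₀ := Int.toNat_of_nonneg (Int.emod_nonneg _ (by exact_mod_cast hn₀.ne'))
  have hi : (((i % n₀).toNat : ℕ) : ℤ) + (i / n₀) * n₀ = i := by rw [hk]; exact Int.emod_add_ediv_mul i n₀
  have key := voronoiChain_label_periodic hdeg hσ₂ ε hε hone u hper (((i % n₀).toNat : ℕ) : ℤ) (i / n₀)
  rw [hi] at key
  rw [hcJ φ, key]

include hdeg hab hab1 hθ in
/-- Canonical codes of the same `J i` coincide (`PureCubicCodes.canon_unique` with the `ℚ`-independence of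
`1, θ, θ²/b`). -/
theorem chainCode_unique {c c' : ℕ × List ℤ} (hc : Canon c) (hc' : Canon c') {S : FractionalIdeal (𝓞 K)⁰ K}
    (hcS : ∀ φ : K, Mem θ b c φ ↔ φ ∈ S) (hc'S : ∀ φ : K, Mem θ b c' φ ↔ φ ∈ S) : c = c' :=
  canon_unique θ b (fun _ _ _ h => coords_eq_zero hdeg hab hab1 hθ h) c c' hc hc'
    fun φ => by rw [hcS, hc'S]

include hdeg hσ₂ ε hε hab hab1 hθ in
/-- **`k` unflagged reduction steps along the chain**: from `(code (J i), acc)` the step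
`(c, acc) ↦ ((redL c).1, acc + (redL c).2)` iterated `k` times reaches `(code (J (i + k)), acc')` with
`|acc' − acc − 2^prec (ℓ(i+k) − ℓ(i))| ≤ k`. -/
theorem iterate_chain_step (hlex : LexMinSpec a b K θ σ₁ σ₂ lexE) (hlog : LogSpec a b logE)
    (hinv : InvSpec a b K θ invE) (hscale : ScaleSpec a b K θ latScale)
    (hred : RedLEq a b K θ lexE logE invE latScale redL) (hbig : IsBigEq a b K θ lexE isBigL)
    (cd : ℤ → ℕ × List ℤ) (hcd : ∀ i, Canon (cd i) ∧ ∀ φ : K, Mem θ b (cd i) φ ↔ φ ∈ (FractionalIdeal.spanSingleton (𝓞 K)⁰ (voronoiChain σ₁ σ₂ (1 : FractionalIdeal (𝓞 K)⁰ K) (1 : K) i)⁻¹ * (1 : FractionalIdeal (𝓞 K)⁰ K))) (prec : ℕ) :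
    ∀ (k : ℕ) (i : ℤ) (acc : ℤ),
      ((fun s : (ℕ × List ℤ) × ℤ => ((redL (((a, b), prec), s.1)).1, s.2 + (redL (((a, b), prec), s.1)).2))^[k]
          (cd i, acc)).1 = cd (i + k) ∧
      |((((fun s : (ℕ × List ℤ) × ℤ => ((redL (((a, b), prec), s.1)).1, s.2 + (redL (((a, b), prec), s.1)).2))^[k]
          (cd i, acc)).2 : ℤ) : ℝ) - acc -
        2 ^ prec * (Real.log (σ₁ (voronoiChain σ₁ σ₂ (1 : FractionalIdeal (𝓞 K)⁰ K) (1 : K) (i + k))) - Real.log (σ₁ (voronoiChain σ₁ σ₂ (1 : FractionalIdeal (𝓞 K)⁰ K) (1 : K) i)))| ≤ k := by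
  intro k
  induction k with
  | zero => intro i acc; simp
  | succ k ih =>
    intro i acc
    obtain ⟨ih1, ih2⟩ := ih i acc
    rw [Function.iterate_succ_apply']
    set x := (fun s : (ℕ × List ℤ) × ℤ => ((redL (((a, b), prec), s.1)).1, s.2 + (redL (((a, b), prec), s.1)).2))^[k]
      (cd i, acc) with hx
    obtain ⟨-, ⟨hcan, hmem⟩, hlog1, -⟩ := chain_step hdeg hσ₂ ε hε hab hθ hlex hlog hinv hscale hred hbig prec (i + k)
      (hcd (i + k)).1 (hcd (i + k)).2
    rw [← ih1] at hcan hmem hlog1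
    refine ⟨?_, ?_⟩
    · show (redL (((a, b), prec), x.1)).1 = cd (i + ((k + 1 : ℕ) : ℤ))
      rw [show i + ((k + 1 : ℕ) : ℤ) = i + k + 1 by push_cast; ring]
      exact chainCode_unique hdeg hab hab1 hθ hcan (hcd (i + k + 1)).1 hmem (hcd (i + k + 1)).2
    · show |(((x.2 + (redL (((a, b), prec), x.1)).2 : ℤ)) : ℝ) - acc -
        2 ^ prec * (Real.log (σ₁ (voronoiChain σ₁ σ₂ (1 : FractionalIdeal (𝓞 K)⁰ K) (1 : K) (i + ((k + 1 : ℕ) : ℤ)))) - Real.log (σ₁ (voronoiChain σ₁ σ₂ (1 : FractionalIdeal (𝓞 K)⁰ K) (1 : K) i)))| ≤ ((k + 1 : ℕ) : ℝ)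
      rw [show i + ((k + 1 : ℕ) : ℤ) = i + k + 1 by push_cast; ring]
      push_cast
      have e : ((x.2 : ℤ) : ℝ) + ((redL (((a, b), prec), x.1)).2 : ℝ) - acc -
          2 ^ prec * (Real.log (σ₁ (voronoiChain σ₁ σ₂ (1 : FractionalIdeal (𝓞 K)⁰ K) (1 : K) (i + k + 1))) - Real.log (σ₁ (voronoiChain σ₁ σ₂ (1 : FractionalIdeal (𝓞 K)⁰ K) (1 : K) i))) =
        (((x.2 : ℤ) : ℝ) - acc - 2 ^ prec * (Real.log (σ₁ (voronoiChain σ₁ σ₂ (1 : FractionalIdeal (𝓞 K)⁰ K) (1 : K) (i + k))) - Real.log (σ₁ (voronoiChain σ₁ σ₂ (1 : FractionalIdeal (𝓞 K)⁰ K) (1 : K) i)))) +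
        (((redL (((a, b), prec), x.1)).2 : ℝ) - 2 ^ prec * (Real.log (σ₁ (voronoiChain σ₁ σ₂ (1 : FractionalIdeal (𝓞 K)⁰ K) (1 : K) (i + k + 1))) - Real.log (σ₁ (voronoiChain σ₁ σ₂ (1 : FractionalIdeal (𝓞 K)⁰ K) (1 : K) (i + k))))) := by
        ring
      rw [e]
      exact (abs_add_le _ _).trans (add_le_add ih2 hlog1)

include hdeg hσ₂ ε hε hab hab1 hθ in
/-- **The flagged loop along the chain stops at the first big gap.** If the big-gap test fails at
`i, …, i + k − 1` and holds at `i + k`, `k ≤ N`, then `N` rounds of the flagged loop of the walk programs from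
`((code (J i), acc), isBigL (code (J i)))` end at `(k unflagged steps, true)`. -/
theorem flagLoop_chain (hlex : LexMinSpec a b K θ σ₁ σ₂ lexE) (hlog : LogSpec a b logE)
    (hinv : InvSpec a b K θ invE) (hscale : ScaleSpec a b K θ latScale)
    (hred : RedLEq a b K θ lexE logE invE latScale redL) (hbig : IsBigEq a b K θ lexE isBigL)
    (cd : ℤ → ℕ × List ℤ) (hcd : ∀ i, Canon (cd i) ∧ ∀ φ : K, Mem θ b (cd i) φ ↔ φ ∈ (FractionalIdeal.spanSingleton (𝓞 K)⁰ (voronoiChain σ₁ σ₂ (1 : FractionalIdeal (𝓞 K)⁰ K) (1 : K) i)⁻¹ * (1 : FractionalIdeal (𝓞 K)⁰ K))) (prec : ℕ)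
    {k N : ℕ} (hkN : k ≤ N) (i : ℤ) (acc : ℤ)
    (hno : ∀ t : ℕ, t < k → ¬ 11 * σ₁ (voronoiChain σ₁ σ₂ (1 : FractionalIdeal (𝓞 K)⁰ K) (1 : K) (i + t)) ≤ 10 * σ₁ (voronoiChain σ₁ σ₂ (1 : FractionalIdeal (𝓞 K)⁰ K) (1 : K) (i + t + 1)))
    (hyes : 11 * σ₁ (voronoiChain σ₁ σ₂ (1 : FractionalIdeal (𝓞 K)⁰ K) (1 : K) (i + k)) ≤ 10 * σ₁ (voronoiChain σ₁ σ₂ (1 : FractionalIdeal (𝓞 K)⁰ K) (1 : K) (i + k + 1))) :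
    (fun s : ((ℕ × List ℤ) × ℤ) × Bool => if s.2 = true then s else
        (((redL (((a, b), prec), s.1.1)).1, s.1.2 + (redL (((a, b), prec), s.1.1)).2),
          isBigL ((a, b), (redL (((a, b), prec), s.1.1)).1)))^[N] ((cd i, acc), isBigL ((a, b), cd i)) =
      ((fun s : (ℕ × List ℤ) × ℤ => ((redL (((a, b), prec), s.1)).1, s.2 + (redL (((a, b), prec), s.1)).2))^[k]
          (cd i, acc), true) := by
  have hflag : ∀ t : ℕ, (isBigL ((a, b), (((fun s : (ℕ × List ℤ) × ℤ =>
      ((redL (((a, b), prec), s.1)).1, s.2 + (redL (((a, b), prec), s.1)).2))^[t] (cd i, acc)).1)) = true ↔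
        11 * σ₁ (voronoiChain σ₁ σ₂ (1 : FractionalIdeal (𝓞 K)⁰ K) (1 : K) (i + t)) ≤ 10 * σ₁ (voronoiChain σ₁ σ₂ (1 : FractionalIdeal (𝓞 K)⁰ K) (1 : K) (i + t + 1))) := fun t => by
    rw [(iterate_chain_step hdeg hσ₂ ε hε hab hab1 hθ hlex hlog hinv hscale hred hbig cd hcd prec t i acc).1]
    exact (chain_step hdeg hσ₂ ε hε hab hθ hlex hlog hinv hscale hred hbig prec (i + t) (hcd (i + t)).1
      (hcd (i + t)).2).2.2.2
  exact iterate_flag_eq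
    (fun s : (ℕ × List ℤ) × ℤ => ((redL (((a, b), prec), s.1)).1, s.2 + (redL (((a, b), prec), s.1)).2))
    (fun s : (ℕ × List ℤ) × ℤ => isBigL ((a, b), s.1)) k N (cd i, acc) hkN
    (fun t ht => Bool.eq_false_iff.mpr fun h => hno t ht ((hflag t).1 h)) ((hflag k).2 hyes)

end Chain

/-! ### Index combinatorics of the big-gap enumeration -/

section Index

/-- **The next enumerated index**: a strictly increasing `s : ℤ → ℤ` with `s (i + nS) = s i + n₀`, `n₀ > 0`,
is unbounded in both directions, so every `j` has a unique `i` with `s (i − 1) < j ≤ s i`. -/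
theorem exists_sIndex {s : ℤ → ℤ} (hsm : StrictMono s) {n₀ nS : ℕ} (hn₀ : 0 < n₀)
    (hper : ∀ i, s (i + nS) = s i + n₀) (j : ℤ) : ∃ i, s (i - 1) < j ∧ j ≤ s i := by
  have hq : ∀ q : ℤ, s (0 + q * nS) = s 0 + q * n₀ := fun q => by
    have h := apply_add_int_mul_period hper 0 q
    rwa [smul_eq_mul] at h
  have hup : ∃ i, j ≤ s i := by
    refine ⟨0 + (j - s 0).toNat * nS, ?_⟩
    rw [show ((j - s 0).toNat : ℤ) * (nS : ℤ) = ((j - s 0).toNat : ℤ) * nS from rfl, hq]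
    have h1 : j - s 0 ≤ ((j - s 0).toNat : ℤ) := Int.self_le_toNat _
    have h2 : ((j - s 0).toNat : ℤ) ≤ ((j - s 0).toNat : ℤ) * n₀ := le_mul_of_one_le_right (by positivity) (by exact_mod_cast hn₀)
    linarith
  have hbdd : ∃ B, ∀ z, j ≤ s z → B ≤ z := by
    refine ⟨0 + (-(((s 0 - j).toNat : ℤ) + 1)) * nS, fun z hz => ?_⟩
    by_contra hcon
    push Not at hcon
    have h := hsm hcon
    rw [hq] at h
    have h1 : s 0 - j ≤ ((s 0 - j).toNat : ℤ) := Int.self_le_toNat _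
    have h2 : (((s 0 - j).toNat : ℤ) + 1) ≤ (((s 0 - j).toNat : ℤ) + 1) * n₀ :=
      le_mul_of_one_le_right (by positivity) (by exact_mod_cast hn₀)
    nlinarith
  obtain ⟨i, hi, hleast⟩ := Int.exists_least_of_bdd hbdd hup
  refine ⟨i, ?_, hi⟩
  by_contra hcon
  push Not at hcon
  have := hleast (i - 1) hcon
  omega

/-- **The window after an index.** For the enumeration `s` of the big-gap indices (`big (s i)` for all `i`, every
big-gap index is enumerated, consecutive enumerated indices at most `6` apart): if `s (i − 1) < j ≤ s i` then
`s i − j ≤ 5`, no index in `[j, s i)` is a big gap, and `s i` is. -/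
theorem sIndex_window {s : ℤ → ℤ} (hsm : StrictMono s) (big : ℤ → Prop) (hbig : ∀ i, big (s i))
    (hsurj : ∀ j, big j → ∃ i, s i = j) (h6 : ∀ i, s (i + 1) ≤ s i + 6) {i j : ℤ} (h1 : s (i - 1) < j)
    (h2 : j ≤ s i) :
    (s i - j).toNat ≤ 5 ∧ (∀ t : ℕ, t < (s i - j).toNat → ¬ big (j + t)) ∧ big (j + ((s i - j).toNat : ℕ)) ∧
      j + ((s i - j).toNat : ℕ) = s i := by
  have h6' := h6 (i - 1)
  rw [sub_add_cancel] at h6'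
  have hk : (((s i - j).toNat : ℕ) : ℤ) = s i - j := Int.toNat_of_nonneg (by omega)
  refine ⟨by omega, fun t ht hb => ?_, by rw [hk, add_sub_cancel]; exact hbig i, by rw [hk, add_sub_cancel]⟩
  obtain ⟨i', hi'⟩ := hsurj _ hb
  have hlt1 : s (i - 1) < s i' := by rw [hi']; omega
  have hlt2 : s i' < s i := by rw [hi']; omega
  have := hsm.lt_iff_lt.mp hlt1
  have := hsm.lt_iff_lt.mp hlt2
  omega

/-- **The window before `s 0`.** If `s 0` is the least nonnegative big-gap index then `s 0 ≤ 5` and no index in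
`[0, s 0)` is a big gap. -/
theorem sZero_window {s : ℤ → ℤ} (hsm : StrictMono s) (big : ℤ → Prop) (hbig : ∀ i, big (s i))
    (h6 : ∀ i, s (i + 1) ≤ s i + 6) (hs0 : 0 ≤ s 0) (hs0min : ∀ j, 0 ≤ j → big j → s 0 ≤ j) :
    (s 0).toNat ≤ 5 ∧ (∀ t : ℕ, t < (s 0).toNat → ¬ big ((0 : ℤ) + t)) ∧ big ((0 : ℤ) + ((s 0).toNat : ℕ)) ∧
      (0 : ℤ) + ((s 0).toNat : ℕ) = s 0 := by
  have hneg : s (-1) < 0 := by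
    by_contra hcon
    push Not at hcon
    have h1 := hs0min _ hcon (hbig (-1))
    have h2 := hsm (show (-1 : ℤ) < 0 by norm_num)
    omega
  have h6' := h6 (-1)
  norm_num at h6'
  have hk : (((s 0).toNat : ℕ) : ℤ) = s 0 := Int.toNat_of_nonneg hs0
  refine ⟨by omega, fun t ht hb => ?_, by rw [hk, zero_add]; exact hbig 0, by rw [hk, zero_add]⟩
  have := hs0min _ (by omega) hb
  omega

end Index

/-! ### Closed form: the code function of the chain -/

/-- **The reduced ideals along Voronoi's chain of `𝓞_K` have canonical codes** (closed form of `exists_chainCode`,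
with the code function chosen): for `θ³ = ab²` (`ab` squarefree, `≠ 1`) in a cubic field `K` with a real embedding
`σ₁`, a non-real `σ₂` and a unit `ε` with `σ₁ ε > 1`, under the specifications `LexMinSpec`, `LogSpec`, `InvSpec`,
`ScaleSpec`, `RedLEq`, `IsBigEq`, `OrdSpec` and a unit period `n₀ > 0` of the chain `ν = voronoiChain σ₁ σ₂ 𝓞_K 1`,
there is `cd : ℤ → ℕ × List ℤ` with `cd i` THE canonical code of `ν(i)⁻¹ 𝓞_K`. -/
theorem exists_chainCodes : ∀ (a b : ℕ), Squarefree (a * b) → a * b ≠ 1 →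
    ∀ (K : Type) [Field K] [NumberField K], Module.finrank ℚ K = 3 → ∀ θ : K, θ ^ 3 = ((a * b ^ 2 : ℕ) : K) →
    ∀ (σ₁ : K →+* ℝ) (σ₂ : K →+* ℂ), (∃ z : K, starRingEnd ℂ (σ₂ z) ≠ σ₂ z) →
    ∀ (ε : (𝓞 K)ˣ), 1 < σ₁ (algebraMap (𝓞 K) K ε) →
    ∀ (lexE : (ℕ × ℕ) × (ℕ × List ℤ) → ℤ × ℤ × ℤ × ℕ) (logE : (ℕ × ℕ) × ((ℤ × ℤ × ℤ × ℕ) × ℕ) → ℤ)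
      (invE : (ℕ × ℕ) × (ℤ × ℤ × ℤ × ℕ) → ℤ × ℤ × ℤ × ℕ)
      (latScale : (ℕ × ℕ) × ((ℕ × List ℤ) × (ℤ × ℤ × ℤ × ℕ)) → ℕ × List ℤ) (ordL : ℕ × ℕ → ℕ × List ℤ)
      (redL : ((ℕ × ℕ) × ℕ) × (ℕ × List ℤ) → (ℕ × List ℤ) × ℤ) (isBigL : (ℕ × ℕ) × (ℕ × List ℤ) → Bool),
    CubicClassTable.LexMinSpec a b K θ σ₁ σ₂ lexE → CubicClassTable.LogSpec a b logE →
    CubicClassTable.InvSpec a b K θ invE → CubicClassTable.ScaleSpec a b K θ latScale →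
    CubicClassTable.OrdSpec a b K θ ordL → CubicClassTable.RedLEq a b K θ lexE logE invE latScale redL →
    CubicClassTable.IsBigEq a b K θ lexE isBigL →
    ∀ (n₀ : ℕ), 0 < n₀ → ∀ (u : (𝓞 K)ˣ), (∀ i : ℤ, voronoiChain σ₁ σ₂ (1 : FractionalIdeal (𝓞 K)⁰ K) (1 : K) (i + n₀) =
      algebraMap (𝓞 K) K u * voronoiChain σ₁ σ₂ (1 : FractionalIdeal (𝓞 K)⁰ K) (1 : K) i) →
    ∃ cd : ℤ → ℕ × List ℤ, ∀ i : ℤ, PureCubicCodes.Canon (cd i) ∧ ∀ φ : K, PureCubicCodes.Mem θ b (cd i) φ ↔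
      φ ∈ FractionalIdeal.spanSingleton (𝓞 K)⁰ (voronoiChain σ₁ σ₂ (1 : FractionalIdeal (𝓞 K)⁰ K) (1 : K) i)⁻¹ *
        (1 : FractionalIdeal (𝓞 K)⁰ K) := by
  intro a b hab hab1 K _ _ hdeg θ hθ σ₁ σ₂ hσ₂ ε hε lexE logE invE latScale ordL redL isBigL hlex hlog hinv hscale hord
    hred hbig n₀ hn₀ u hper
  exact ⟨fun i => (exists_chainCode hdeg hσ₂ ε hε hab hθ hlex hlog hinv hscale hred hbig hord hn₀ u hper i).choose,
    fun i => (exists_chainCode hdeg hσ₂ ε hε hab hθ hlex hlog hinv hscale hred hbig hord hn₀ u hper i).choose_spec⟩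

end Summit.QuantumAdvantage.QuantumAdvantage.Theorems.LinnikCubicClassGroups
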